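import Summits.Ventures.PercRepro.C041BlockMapEmbed
import Summits.Ventures.PercRepro.C041BlockMapOneExit
import Summits.Ventures.PercRepro.C041BlockMapUnit
import Summits.Ventures.PercRepro.C041BlockMapTriangleHosts
import Summits.Ventures.PercRepro.C041BlockMapAnchorExit

/-!
# ROW C-041 — THEOREM (PENDANT VERTEX WITH EXITS) and THEOREM (ISOLATED VERTEX WITH EXITS): a new vertex carrying
any number of exits (p6, gen 37)

`Built.addPendant` (`C041BlockMapClosure`) adds a pendant vertex that is NEITHER an exit nor the anchor; this
module lets the new vertex carry exits.  THE PENDANT VERTEX: for a host `Z₁`, a vertex `x` and exits `u₁` at old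
vertices together with any family of exits at the new vertex, `addPendant Z₁ x` is a cone host at the old anchor
as soon as `Z₁` is a cone host with the exits `u₁` and the extra exit `x` (`coneHost_addPendant_split`;
`coneHost_addPendant_of_uplus` for an arbitrary family `u' : ι → Option V₁`).  PROOF: the host with a pendant
vertex embeds (`embAddPendant`, a `ZoneEmb`) into the wedge of `Z₁` with the edge host hung at `x`
(`Built.hang`; the edge host with all its exits at its far end is a cone host by THEOREM (COINCIDENT EXITS),
for an empty family by THEOREM (UNIT EXIT)), and the stray vertex of the wedge is removed by
`coneHost_of_emb` (`C041BlockMapEmbed`).  THE ISOLATED VERTEX: likewise with the edgeless pair hung at the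
anchor (`addIsolated`, `embAddIsolated`, `coneHost_addIsolated_split`, `coneHost_addIsolated_of`).  The
forest theorem (every forest host, any exits, any anchor in it, is a cone host) is the companion module
`C041BlockMapForest`.
-/

namespace PercRepro

namespace ZoneZ

namespace MultiExit

open ZoneData Pendant Finset TwoExit TreeClosure

/-! ## Coincident exits, the empty family included -/

/-- THEOREM (COINCIDENT EXITS) for a possibly empty family of exits: every host with all its exits at one vertex
is a cone host (through THEOREM (UNIT EXIT) when the family is empty). -/
theorem coneHost_const' {V₁ E₁ U₁ U₂ : Type} (Z₁ : ZoneData V₁ E₁ U₁ U₂) (v a₁ : V₁) [Fintype E₁]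
    [DecidableEq E₁] {ι : Type} [Fintype ι] : ConeHost Z₁ (fun _ : ι => v) a₁ := by
  have e : uplus (fun _ : ι => v) v = fun _ : Option ι => v := by
    funext o
    cases o <;> rfl
  have h : ConeHost Z₁ (uplus (fun _ : ι => v) v) a₁ := by
    rw [e]
    exact coneHost_const Z₁ v a₁
  exact coneHost_of_coneHost_uplus Z₁ _ a₁ v h

section Pendant

variable {V₁ E₁ U₁ U₂ : Type} (Z₁ : ZoneData V₁ E₁ U₁ U₂) (x a₁ : V₁) [Fintype E₁] [DecidableEq E₁]

/-! ## The host with a pendant vertex embeds into the wedge with the edge host hung at `x` -/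

/-- The vertex map of the embedding: an old vertex to the left side, the new vertex to the far end of the
edge host. -/
def pendantVertexMap : Option V₁ → V₁ ⊕ Bool := fun o => o.elim (Sum.inr true) Sum.inl

omit [Fintype E₁] [DecidableEq E₁] in
/-- The vertex map is injective. -/
theorem pendantVertexMap_injective : Function.Injective (pendantVertexMap (V₁ := V₁)) := by
  intro o o' h
  cases o with
  | none =>
    cases o' with
    | none => rfl
    | some y => exact absurd h Sum.inr_ne_inl
  | some y =>
    cases o' with
    | none => exact absurd h Sum.inl_ne_inr
    | some y' => rw [Sum.inl.inj h]

/-- The embedding of `addPendant Z₁ x` into the wedge of `Z₁` with the edge host hung at `x`: the pendant edge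
is the edge of the edge host, whose far end `inr true` is the pendant vertex. -/
def embAddPendant : ZoneEmb (addPendant Z₁ x) (wedge Z₁ edgeHost x false) where
  v := pendantVertexMap
  inj := pendantVertexMap_injective
  e := Equiv.optionEquivSumPUnit E₁
  t₁ := (Equiv.sumEmpty U₁ Empty).symm
  t₂ := (Equiv.sumEmpty U₂ Empty).symm
  fst_map := by
    intro e
    cases e with
    | none =>
      rw [Equiv.optionEquivSumPUnit_none]
      exact redW_anchor x false
    | some e => rfl
  snd_map := by
    intro e
    cases e with
    | none =>
      rw [Equiv.optionEquivSumPUnit_none]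
      exact redW_of_ne x false (by decide : (true : Bool) ≠ false)
    | some e => rfl
  at₁_map := fun _ => rfl
  at₂_map := fun _ => rfl

/-! ## THEOREM (PENDANT VERTEX WITH EXITS) -/

/-- **THEOREM (PENDANT VERTEX WITH EXITS), split form**: exits `u₁` at old vertices and a family `ι₂` of exits at
the new pendant vertex; the host with the pendant vertex is a cone host at the old anchor as soon as `Z₁` is a
cone host with the exits `u₁` and the extra exit `x`. -/
theorem coneHost_addPendant_split {ι₁ ι₂ : Type} [Fintype ι₁] [DecidableEq ι₁] [Fintype ι₂] [DecidableEq ι₂]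
    (u₁ : ι₁ → V₁) (h : ConeHost Z₁ (uplus u₁ x) a₁) :
    ConeHost (addPendant Z₁ x) (Sum.elim (fun k => some (u₁ k)) fun _ : ι₂ => none) (some a₁) := by
  have hb : ConeHost (wedge Z₁ edgeHost x false) (wexits x false u₁ fun _ : ι₂ => true) (Sum.inl a₁) :=
    coneHost_of_built (Built.hang Z₁ edgeHost u₁ (fun _ => true) a₁ x false (Built.core _ _ _ h)
      (Built.core _ _ _ (coneHost_const' edgeHost true false)))
  refine coneHost_of_emb (embAddPendant Z₁ x) _ (some a₁) ?_ rfl hb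
  intro k
  rcases k with k | k
  · rfl
  · exact redW_of_ne x false (by decide : (true : Bool) ≠ false)

/-- The exits at old vertices of a family `u' : ι → Option V₁`. -/
def oldExits {ι : Type} (u' : ι → Option V₁) : {k // (u' k).isSome = true} → V₁ :=
  fun k => (u' k.1).get k.2

omit [Fintype E₁] [DecidableEq E₁] in
/-- The split family re-indexed along `Equiv.sumCompl` is the family. -/
theorem sum_elim_oldExits_comp {ι : Type} (u' : ι → Option V₁) :
    (Sum.elim (fun k => some (oldExits u' k)) fun _ : {k // ¬ (u' k).isSome = true} => (none : Option V₁)) ∘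
      (Equiv.sumCompl fun k => (u' k).isSome = true).symm = u' := by
  funext k
  by_cases hk : (u' k).isSome = true
  · rw [Function.comp_apply, Equiv.sumCompl_symm_apply_of_pos (p := fun k => (u' k).isSome = true) hk, Sum.elim_inl]
    exact Option.some_get hk
  · rw [Function.comp_apply, Equiv.sumCompl_symm_apply_of_neg (p := fun k => (u' k).isSome = true) hk, Sum.elim_inr]
    exact (Option.not_isSome_iff_eq_none.1 hk).symm

/-- **THEOREM (PENDANT VERTEX WITH EXITS)**: for any family of exits `u'` of the host with a pendant vertex, the
host is a cone host at the old anchor as soon as `Z₁` is a cone host with the exits of `u'` at old vertices and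
the extra exit `x`. -/
theorem coneHost_addPendant_of_uplus {ι : Type} [Fintype ι] [DecidableEq ι] (u' : ι → Option V₁)
    (h : ConeHost Z₁ (uplus (oldExits u') x) a₁) : ConeHost (addPendant Z₁ x) u' (some a₁) := by
  have hs := coneHost_addPendant_split Z₁ x a₁ (ι₂ := {k // ¬ (u' k).isSome = true}) (oldExits u') h
  have hr := coneHost_reindex (Equiv.sumCompl fun k => (u' k).isSome = true).symm hs
  rwa [sum_elim_oldExits_comp] at hr

end Pendant

/-! ## An isolated vertex -/

section Isolated

variable {V₁ E₁ U₁ U₂ : Type} (Z₁ : ZoneData V₁ E₁ U₁ U₂) (a₁ : V₁) [Fintype E₁] [DecidableEq E₁]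

/-- The host with a new isolated vertex `none`. -/
def addIsolated : ZoneData (Option V₁) E₁ U₁ U₂ where
  fst := fun e => some (Z₁.fst e)
  snd := fun e => some (Z₁.snd e)
  at₁ := fun t => some (Z₁.at₁ t)
  at₂ := fun t => some (Z₁.at₂ t)

/-- The embedding of `addIsolated Z₁` into the wedge of `Z₁` with the edgeless pair hung at the anchor: the new
vertex is the far vertex `inr true` of the pair. -/
def embAddIsolated : ZoneEmb (addIsolated Z₁) (wedge Z₁ pairHost a₁ false) where
  v := pendantVertexMap
  inj := pendantVertexMap_injective
  e := (Equiv.sumEmpty E₁ Empty).symm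
  t₁ := (Equiv.sumEmpty U₁ Empty).symm
  t₂ := (Equiv.sumEmpty U₂ Empty).symm
  fst_map := fun _ => rfl
  snd_map := fun _ => rfl
  at₁_map := fun _ => rfl
  at₂_map := fun _ => rfl

/-- **THEOREM (ISOLATED VERTEX WITH EXITS), split form**: exits `u₁` at old vertices and a family `ι₂` of exits at
the new isolated vertex; the host is a cone host at the old anchor as soon as `Z₁` is a cone host with the exits
`u₁` and an extra exit at the anchor. -/
theorem coneHost_addIsolated_split {ι₁ ι₂ : Type} [Fintype ι₁] [DecidableEq ι₁] [Fintype ι₂] [DecidableEq ι₂]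
    (u₁ : ι₁ → V₁) (h : ConeHost Z₁ (uplus u₁ a₁) a₁) :
    ConeHost (addIsolated Z₁) (Sum.elim (fun k => some (u₁ k)) fun _ : ι₂ => none) (some a₁) := by
  have hb : ConeHost (wedge Z₁ pairHost a₁ false) (wexits a₁ false u₁ fun _ : ι₂ => true) (Sum.inl a₁) :=
    coneHost_of_built (Built.hang Z₁ pairHost u₁ (fun _ => true) a₁ a₁ false (Built.core _ _ _ h)
      (Built.core _ _ _ (coneHost_const' pairHost true false)))
  refine coneHost_of_emb (embAddIsolated Z₁ a₁) _ (some a₁) ?_ rfl hb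
  intro k
  rcases k with k | k
  · rfl
  · exact redW_of_ne a₁ false (by decide : (true : Bool) ≠ false)

/-- **THEOREM (ISOLATED VERTEX WITH EXITS)**: for any family of exits `u'` of the host with an isolated vertex,
the host is a cone host at the old anchor as soon as `Z₁` is a cone host with the exits of `u'` at old vertices
and an extra exit at the anchor. -/
theorem coneHost_addIsolated_of_uplus {ι : Type} [Fintype ι] [DecidableEq ι] (u' : ι → Option V₁)
    (h : ConeHost Z₁ (uplus (oldExits u') a₁) a₁) : ConeHost (addIsolated Z₁) u' (some a₁) := by
  have hs := coneHost_addIsolated_split Z₁ a₁ (ι₂ := {k // ¬ (u' k).isSome = true}) (oldExits u') h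
  have hr := coneHost_reindex (Equiv.sumCompl fun k => (u' k).isSome = true).symm hs
  rwa [sum_elim_oldExits_comp] at hr

/-- With THEOREM (ANCHOR EXIT): the host with an isolated vertex is a cone host for any family of exits as soon
as `Z₁` is a cone host with the exits of that family at old vertices. -/
theorem coneHost_addIsolated_of {ι : Type} [Fintype ι] [DecidableEq ι] (u' : ι → Option V₁)
    (h : ConeHost Z₁ (oldExits u') a₁) : ConeHost (addIsolated Z₁) u' (some a₁) :=
  coneHost_addIsolated_of_uplus Z₁ a₁ u' (coneHost_uplus_anchor Z₁ _ a₁ h)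

end Isolated

end MultiExit

end ZoneZ

end PercRepro
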